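import Literature.Geometry.Kaehler.ComplexTorusAlbertTypeIVLefschetzGroupConnected
import Literature.Geometry.Kaehler.ComplexTorusComplexMultiplicationLefschetzGroupLinearFactors
import Literature.Geometry.Kaehler.ComplexTorusMatrixUnitFamilyCentreEigenspaces
import HarnessLib

/-!
# Milne 1999 §2, «simple abelian variety of type IV», the «Group» column for EVERY degree `d`:
# `S(X)(ℂ) ≃* ∏_{w : InfinitePlace K} GL_{m_w}(ℂ)` for a simple polarised complex torus of Albert type IV —
# Remark 2.2 «`α ↦ α|V₁ : U(φ)_Ω → GL(V₁)` is an isomorphism» in coordinates, applied to the paired frame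

Layer `Literature/Geometry/Kaehler`, namespace `Literature.Geometry.Kaehler.ComplexTorus`; lane `lit-hodgefound`
(Track 2 foundations library), Layer A4 (Lefschetz groups), prover seat `lit-hodgefound-p17` (generation 61),
self-proposed rows g61-#8 and g62-#8 (§2 core with ranks, the uniform `_of_central` form and the «`f` copies» front-ends) — the every-`d` complement of g61-#3 ∕ g61-#4 (`d = 1`, where the frame is the centre's
unitary eigenframe), BY NAME on skel-4's A4-90 FILE 1 `ComplexTorusLefschetzGroupMatrixUnitPairFamilyConnected`
(`exists_frame_lefschetzGroupC_eq_conj_diagPow_pi_of_matrixUnitPairFamily`, the paired-frame identity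
`S(X)(ℂ) = P · eι(Δ_d(diag_w U_w)) · P⁻¹` exported in g61-#7), FILE 2 `ComplexTorusAlbertTypeIVLefschetzGroupConnected`
(`IsSimple.exists_matrixUnitPairFamily_of_isAlbertTypeIV`), skel-4's `ComplexTorusSiegelLeviConnected`
(`siegelLevi`, `mem_siegelLevi_iff`, `eq_fromBlocks_toBlocks₁₂_of_transpose_eq_neg`, `transpose_mul_fromBlocks_mul_eq_J`),
g61-#3 `ComplexTorusComplexMultiplicationLefschetzGroupLinearFactors` (`exists_mulEquiv_siegelLevi_generalLinearGroup`:
`{diag(g, ᵗg⁻¹)} ≃* GL`), `ComplexTorusSymplecticGroupGramConnected` (`reindexSLC`, `conjGLC`),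
`ComplexTorusRealMultiplicationLefschetzGroupConnected` (`conj_symplectic_iff`), `ComplexTorusLefschetzGroupSigmaPi`
(`subgroupPiMulEquiv'`), `ComplexTorusHodgeGroupSigmaPi` (`sigmaBlockDiagSL_injective`),
`ComplexTorusLefschetzGroupPowerIdentityComponent` (`diagPowSLC_injective`).  THEOREMS ONLY (no definition, no
instance, no notation, no named fact; D-0026, net debt 0).

## Sources, verbatim

* J. S. Milne, *Lefschetz classes on abelian varieties*, Duke Math. J. **96** (1999) 639–675 (held
  `paper:doi-10-1215-s0012-7094-99-09620-5`). §2 Remark 2.2 (p. 647–648 = PDF p0009 L48–L70, p0010 L1–L7): «[…] there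
  is a nondegenerate `Ω`-bilinear form `φ₁ : V₁ × V₂ → Ω` such that `φ((x₁, x₂), (y₁, y₂)) = (φ₁(x₁, y₂), −φ₁(x₂, y₁))`
  […] Therefore, the map `α ↦ α|V₁ : U(φ)_Ω → GL(V₁)` is an isomorphism»; p. 651 (p0013 L8–L30, L74–L82): «*Simple
  abelian variety of type IV.* […] `E ⊗_{F,σ} k^al ≈ M_d(k^al) × M_d(k^al)` […] `S(A)_{/k^al} = ∏ S_σ` where
  `S_σ ≈ Aut_{M_d(k^al)}(V₁) ≈ GL_{g/(fd)}(k^al)`. The representation of `S_σ` on `V_σ` is isomorphic to the direct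
  sum of `d` copies of the standard representation of `GL_{g/(fd)}` and `d` copies of its contragredient»; Summary
  p. 652: «IV ∣ GL_{g/(df)} ∣ No ∣ Yes» and «The group `S(A)_{/k^al}` is isomorphic to `f` copies of the group listed».
* H. Lange, *Abelian Varieties over the Complex Numbers* (2023), Thm. 2.6.5 ∕ §2.6.1 (type IV: central simple of
  degree `d²` over a CM field `K`, `[K:ℚ] = 2e₀`, «`End_ℚ(X) ⊗ ℝ ≃ ∏_{e₀} M_d(ℂ)`»), §7.2.4 Exercise (4).

## What is proved

* §1 REMARK 2.2 IN PAIR COORDINATES: **`exists_mulEquiv_generalLinearGroup_of_unitaryPair`** — for an alternating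
  invertible `H` on `ℂ^{Fin 2 × Fin m}` vanishing on `V₀ × V₀` and `V₁ × V₁` (`V_s = {s} × Fin m`), the subgroup
  `U = {N ∈ SL ∣ ᵗN H N = H, N(V_s) ⊆ V_s}` (given by this membership condition) is `≃* GL_m(ℂ)` by `N ↦ N|V₀`
  (through `Q⁻¹ · N · Q ∈ {diag(g, ᵗg⁻¹)}`, `Q = diag(1, −A⁻¹)`).
* §2 **`exists_mulEquiv_lefschetzGroupC_pi_generalLinearGroup_of_matrixUnitPairFamily`** — for a complete family of
  paired `d × d` matrix-unit systems in `End_ℚ(X) ⊗ ℂ` with pair-swapping adjoints (hypotheses of FILE 1):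
  `S(X)(ℂ) ≃* ∏_{w} GL_{m_w}(ℂ)` with `d · Σ_w 2 m_w = #ι`; its core
  **`exists_rank_eq_and_mulEquiv_lefschetzGroupC_pi_generalLinearGroup_of_matrixUnitPairFamily`** records the block
  sizes as ranks, `rank (Σ_a e w s a a) = d · m_w` (`rank_sum_eq_of_mul_eq_mul_single_kronecker_submatrix` of
  `ComplexTorusMatrixUnitFamilyCentreEigenspaces`); and
  **`exists_mulEquiv_lefschetzGroupC_fun_generalLinearGroup_of_matrixUnitPairFamily_of_central`** — when the family is
  indexed by `W` with `2 · #W = [K:ℚ]` for a CENTRAL number field `K ⊆ End_ℚ(X)`, the sizes are UNIFORM: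
  `S(X)(ℂ) ≃* GL_m(ℂ)^W` with `d · m · [K:ℚ] = #ι` (the paired centre dictionary
  `exists_equiv_embeddings_of_matrixUnitPairFamily_of_central`: `ε_{w,s} = Σ_a e w s a a` is the spectral projector of
  `K` at the embedding `c (w,s)`, `rank ε_{w,s} · [K:ℚ] = #ι` — Milne's «`V_i = e_i V` has dimension `2g/f`»).
* §3 **`IsSimple.nonempty_lefschetzGroupC_mulEquiv_pi_generalLinearGroup_of_isAlbertTypeIV`** — for a SIMPLE
  polarised complex torus of Albert type IV (every `d = √[End⁰(X):K]`): `S(X)(ℂ) ≃* ∏_{w : InfinitePlace K} GL_{m_w}(ℂ)`,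
  `d · Σ_w 2 m_w = 2g`; and `IsSimple.nonempty_lefschetzIdentityC_mulEquiv_pi_generalLinearGroup_of_isAlbertTypeIV`
  (Lange's `Lf`, `= S` by FILE 2); and the table entry with its multiplicity,
  **`IsSimple.nonempty_lefschetzGroupC_mulEquiv_fun_generalLinearGroup_of_isAlbertTypeIV`**:
  `S(X)(ℂ) ≃* GL_m(ℂ)^{InfinitePlace K}` with `d · m · [K:ℚ] = 2g`, i.e. EXACTLY «`f` copies of `GL_{g/(df)}`»
  (`f = #InfinitePlace K = e₀`, `[K:ℚ] = 2e₀` for the CM centre `K`), and its `Lf` twin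
  `IsSimple.nonempty_lefschetzIdentityC_mulEquiv_fun_generalLinearGroup_of_isAlbertTypeIV`.

NOT here: types II and III (`Sp_{g/f}`, `O_{g/f}`): `ComplexTorusAlbertTypeIILefschetzGroupSymplecticFactors`,
`ComplexTorusAlbertTypeIIILefschetzGroupOrthogonalFactors`.
-/

open Module Matrix NumberField
open Literature.RingTheory.CentralSimple (IsAlbertTypeIV)

namespace Literature.Geometry.Kaehler

namespace ComplexTorus

/-! ## §1 Remark 2.2 in pair coordinates: the unitary-pair group is `GL(V₁)` -/

section UnitaryPair

/-- Transport of `ᵗX H X = H` along a relabelling of the indices. [folklore] -/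
private theorem transpose_mul_mul_submatrix_equiv_iff {α β : Type*} [Fintype α] [Fintype β] [DecidableEq α]
    [DecidableEq β] (e : α ≃ β) (X : Matrix β β ℂ) (H : Matrix α α ℂ) :
    (X.submatrix e e)ᵀ * H * X.submatrix e e = H ↔
      Xᵀ * H.submatrix e.symm e.symm * X = H.submatrix e.symm e.symm := by
  have hH : H = (H.submatrix e.symm e.symm).submatrix e e := by
    simp only [Matrix.submatrix_submatrix, Equiv.symm_comp_self, Matrix.submatrix_id_id]
  constructor
  · intro h
    rw [hH, Matrix.transpose_submatrix, Matrix.submatrix_mul_equiv, Matrix.submatrix_mul_equiv] at h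
    have h' := congrArg (fun M : Matrix α α ℂ ↦ M.submatrix e.symm e.symm) h
    simpa only [Matrix.submatrix_submatrix, Equiv.self_comp_symm, Equiv.symm_comp_self, Function.id_comp,
      Function.comp_id, Matrix.submatrix_id_id] using h'
  · intro h
    rw [hH, Matrix.transpose_submatrix, Matrix.submatrix_mul_equiv, Matrix.submatrix_mul_equiv, h]

/-- `ᵗ(diag(X, Y)) J diag(X, Y) = J` iff `ᵗX Y = 1`. [cite: Milne1999LefschetzClasses, §2 Remark 2.2] -/
private theorem fromBlocks_diag_transpose_mul_J_mul_eq_iff₆₁ {l : Type*} [Fintype l] [DecidableEq l]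
    (X Y : Matrix l l ℂ) :
    (fromBlocks X 0 0 Y)ᵀ * Matrix.J l ℂ * fromBlocks X 0 0 Y = Matrix.J l ℂ ↔ Xᵀ * Y = 1 := by
  rw [Matrix.J, fromBlocks_transpose, fromBlocks_multiply, fromBlocks_multiply]
  simp only [Matrix.mul_zero, Matrix.zero_mul, add_zero, zero_add, Matrix.mul_one, Matrix.mul_neg, Matrix.neg_mul,
    transpose_zero, neg_zero, fromBlocks_inj, neg_inj, true_and, and_true]
  refine ⟨fun h ↦ h.1, fun h ↦ ⟨h, ?_⟩⟩
  rw [← transpose_transpose X, ← transpose_mul, h, transpose_one]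

/-- **MILNE'S REMARK 2.2 IN PAIR COORDINATES — «the map `α ↦ α|V₁ : U(φ)_Ω → GL(V₁)` is an isomorphism».** Let `H` be
an alternating invertible matrix on `ℂ^{Fin 2 × Fin m} = V₀ ⊕ V₁` (`V_s` the vectors supported on `{s} × Fin m`) with
`H|V₀ × V₀ = 0 = H|V₁ × V₁`, and let `U ≤ SL` be the subgroup of the `N` with `ᵗN H N = H` preserving `V₀` and `V₁`
(given by this membership condition).  Then `N ↦ N|V₀` is an isomorphism `U ≃* GL_m(ℂ)` (through the adapted basis
`Q = diag(1, −A⁻¹)`, `ᵗQ H Q = J`, carrying `U` onto the Siegel Levi `{diag(g, ᵗg⁻¹)}`).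
[cite: Milne1999LefschetzClasses, §2 Remark 2.2 (p. 647–648)] [cite: Lange2023AbelianVarietiesComplex, §7.2.4 Exercise (4)] -/
theorem exists_mulEquiv_generalLinearGroup_of_unitaryPair {m : ℕ} {H : Matrix (Fin 2 × Fin m) (Fin 2 × Fin m) ℂ}
    (hHt : Hᵀ = -H) (hHu : IsUnit H.det) (hside : ∀ t t' : Fin 2 × Fin m, t.1 = t'.1 → H t t' = 0)
    {U : Subgroup (SpecialLinearGroup (Fin 2 × Fin m) ℂ)}
    (hU : ∀ N : SpecialLinearGroup (Fin 2 × Fin m) ℂ, N ∈ U ↔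
      N.1ᵀ * H * N.1 = H ∧ ∀ t t' : Fin 2 × Fin m, t.1 ≠ t'.1 → N.1 t t' = 0) :
    ∃ ρ : U ≃* GL (Fin m) ℂ, ∀ (N : U) (i j : Fin m), ((ρ N : GL (Fin m) ℂ) : Matrix (Fin m) (Fin m) ℂ) i j =
      ((N : SpecialLinearGroup (Fin 2 × Fin m) ℂ) : Matrix (Fin 2 × Fin m) (Fin 2 × Fin m) ℂ) (0, i) (0, j) := by
  -- the relabelling `Fin 2 × Fin m ≃ Fin m ⊕ Fin m`
  obtain ⟨ε, hεl, hεr⟩ : ∃ ε : Fin 2 × Fin m ≃ Fin m ⊕ Fin m,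
      (∀ x, ε.symm (Sum.inl x) = (0, x)) ∧ ∀ x, ε.symm (Sum.inr x) = (1, x) :=
    ⟨(finTwoEquiv.prodCongr (Equiv.refl _)).trans (Equiv.boolProdEquivSum _), fun _ ↦ rfl, fun _ ↦ rfl⟩
  -- `H' = (0 A; -ᵗA 0)` with `A` invertible, and the adapted basis `Q`
  set H' : Matrix (Fin m ⊕ Fin m) (Fin m ⊕ Fin m) ℂ := H.submatrix ε.symm ε.symm with hH'
  have hH't : H'ᵀ = -H' := by rw [hH', Matrix.transpose_submatrix, hHt, Matrix.submatrix_neg]; rfl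
  have hH'u : IsUnit H'.det := by rw [hH', Matrix.det_submatrix_equiv_self]; exact hHu
  have h₁₁ : ∀ i j, H' (Sum.inl i) (Sum.inl j) = 0 := fun i j ↦ by
    rw [hH', Matrix.submatrix_apply, hεl, hεl]; exact hside _ _ rfl
  have h₂₂ : ∀ i j, H' (Sum.inr i) (Sum.inr j) = 0 := fun i j ↦ by
    rw [hH', Matrix.submatrix_apply, hεr, hεr]; exact hside _ _ rfl
  set A : Matrix (Fin m) (Fin m) ℂ := H'.toBlocks₁₂ with hA
  have hHeq : H' = fromBlocks 0 A (-Aᵀ) 0 := eq_fromBlocks_toBlocks₁₂_of_transpose_eq_neg hH't h₁₁ h₂₂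
  obtain ⟨X₀, Y₀, W₀, Z₀, hi⟩ : ∃ X Y W Z : Matrix (Fin m) (Fin m) ℂ, H'⁻¹ = fromBlocks X Y W Z :=
    ⟨_, _, _, _, (fromBlocks_toBlocks _).symm⟩
  have hAW : A * W₀ = 1 := by
    have h := mul_nonsing_inv H' hH'u
    rw [hi, hHeq, fromBlocks_multiply, ← fromBlocks_one] at h
    have h1 := (fromBlocks_inj.1 h).1
    rwa [Matrix.zero_mul, zero_add] at h1
  have hAu : IsUnit A.det := Matrix.isUnit_det_of_right_inverse hAW
  set Q : Matrix (Fin m ⊕ Fin m) (Fin m ⊕ Fin m) ℂ := fromBlocks 1 0 0 (-A⁻¹) with hQ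
  have hQQ' : Q * fromBlocks 1 0 0 (-A) = 1 := by
    rw [hQ, fromBlocks_multiply, ← fromBlocks_one]
    simp only [Matrix.mul_zero, Matrix.zero_mul, add_zero, zero_add, Matrix.one_mul, neg_mul_neg,
      nonsing_inv_mul _ hAu]
  have hQu : IsUnit Q.det := Matrix.isUnit_det_of_right_inverse hQQ'
  have hQinv : Q⁻¹ = fromBlocks 1 0 0 (-A) := Matrix.inv_eq_right_inv hQQ'
  have hQJ : Qᵀ * H' * Q = Matrix.J (Fin m) ℂ := by rw [hHeq]; exact transpose_mul_fromBlocks_mul_eq_J hAu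
  -- `φ : N ↦ Q⁻¹ · N^ε · Q` carries `U` onto the Siegel Levi
  let φ : SpecialLinearGroup (Fin 2 × Fin m) ℂ ≃* SpecialLinearGroup (Fin m ⊕ Fin m) ℂ :=
    (reindexSLC ε).trans (conjGLC Q hQu).symm
  have hφ : ∀ N, ((φ N : SpecialLinearGroup (Fin m ⊕ Fin m) ℂ) : Matrix (Fin m ⊕ Fin m) (Fin m ⊕ Fin m) ℂ) =
      Q⁻¹ * (N : Matrix (Fin 2 × Fin m) (Fin 2 × Fin m) ℂ).submatrix ε.symm ε.symm * Q := fun N ↦ by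
    rw [MulEquiv.trans_apply, coe_conjGLC_symm, coe_reindexSLC]
  have hφs : ∀ M, ((φ.symm M : SpecialLinearGroup (Fin 2 × Fin m) ℂ) : Matrix (Fin 2 × Fin m) (Fin 2 × Fin m) ℂ) =
      (Q * (M : Matrix (Fin m ⊕ Fin m) (Fin m ⊕ Fin m) ℂ) * Q⁻¹).submatrix ε ε := fun M ↦ by
    rw [MulEquiv.symm_trans_apply, coe_reindexSLC_symm, MulEquiv.symm_symm, coe_conjGLC]
  have hUφ : U.map φ.toMonoidHom = siegelLevi (Fin m) := by
    ext M
    rw [Subgroup.mem_map_equiv, hU, hφs]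
    obtain ⟨X, B, C, Y, hM⟩ : ∃ X B C Y : Matrix (Fin m) (Fin m) ℂ,
        (M : Matrix (Fin m ⊕ Fin m) (Fin m ⊕ Fin m) ℂ) = fromBlocks X B C Y :=
      ⟨_, _, _, _, (fromBlocks_toBlocks _).symm⟩
    have hconj : Q * (M : Matrix (Fin m ⊕ Fin m) (Fin m ⊕ Fin m) ℂ) * Q⁻¹ =
        fromBlocks X (-(B * A)) (-(A⁻¹ * C)) (A⁻¹ * Y * A) := by
      rw [hQinv, hM, hQ, fromBlocks_multiply, fromBlocks_multiply]
      simp only [Matrix.mul_zero, Matrix.zero_mul, add_zero, zero_add, Matrix.one_mul, Matrix.mul_one,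
        Matrix.neg_mul, Matrix.mul_neg, neg_neg, Matrix.mul_assoc]
    rw [transpose_mul_mul_submatrix_equiv_iff ε, ← hH', conj_symplectic_iff hQu, hQJ, mem_siegelLevi_iff hM]
    have hcorner : (∀ t t' : Fin 2 × Fin m, t.1 ≠ t'.1 →
        (Q * (M : Matrix (Fin m ⊕ Fin m) (Fin m ⊕ Fin m) ℂ) * Q⁻¹).submatrix ε ε t t' = 0) ↔ B = 0 ∧ C = 0 := by
      rw [hconj]
      constructor
      · intro h
        have hB : -(B * A) = 0 := by
          ext i j
          have h1 := h (ε.symm (Sum.inl i)) (ε.symm (Sum.inr j)) (by rw [hεl, hεr]; exact zero_ne_one)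
          rwa [Matrix.submatrix_apply, Equiv.apply_symm_apply, Equiv.apply_symm_apply, fromBlocks_apply₁₂] at h1
        have hC : -(A⁻¹ * C) = 0 := by
          ext i j
          have h1 := h (ε.symm (Sum.inr i)) (ε.symm (Sum.inl j)) (by rw [hεl, hεr]; exact one_ne_zero)
          rwa [Matrix.submatrix_apply, Equiv.apply_symm_apply, Equiv.apply_symm_apply, fromBlocks_apply₂₁] at h1
        rw [neg_eq_zero] at hB hC
        constructor
        · have h2 := congrArg (· * A⁻¹) hB
          simpa only [Matrix.mul_assoc, mul_nonsing_inv _ hAu, Matrix.mul_one, Matrix.zero_mul] using h2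
        · have h2 := congrArg (A * ·) hC
          simpa only [← Matrix.mul_assoc, mul_nonsing_inv _ hAu, Matrix.one_mul, Matrix.mul_zero] using h2
      · rintro ⟨rfl, rfl⟩ t t' htt
        obtain ⟨u, rfl⟩ := ε.symm.surjective t
        obtain ⟨u', rfl⟩ := ε.symm.surjective t'
        rw [Matrix.submatrix_apply, Equiv.apply_symm_apply, Equiv.apply_symm_apply]
        rcases u with i | i <;> rcases u' with j | j
        · rw [hεl, hεl] at htt
          exact absurd rfl htt
        · rw [fromBlocks_apply₁₂, Matrix.zero_mul, neg_zero, Matrix.zero_apply]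
        · rw [fromBlocks_apply₂₁, Matrix.mul_zero, neg_zero, Matrix.zero_apply]
        · rw [hεr, hεr] at htt
          exact absurd rfl htt
    rw [hcorner]
    constructor
    · rintro ⟨hJ, hB, hC⟩
      subst hB hC
      rw [hM] at hJ
      exact ⟨rfl, rfl, (fromBlocks_diag_transpose_mul_J_mul_eq_iff₆₁ X Y).1 hJ⟩
    · rintro ⟨hB, hC, hXY⟩
      subst hB hC
      refine ⟨?_, rfl, rfl⟩
      rw [hM]
      exact (fromBlocks_diag_transpose_mul_J_mul_eq_iff₆₁ X Y).2 hXY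
  -- assemble with `siegelLevi ≃* GL`, `diag(g, ᵗg⁻¹) ↦ g`
  have hUφ' : U.map (φ : SpecialLinearGroup (Fin 2 × Fin m) ℂ →* SpecialLinearGroup (Fin m ⊕ Fin m) ℂ) =
      siegelLevi (Fin m) := hUφ
  obtain ⟨ρ, hρ⟩ := exists_mulEquiv_siegelLevi_generalLinearGroup (l := Fin m)
  refine ⟨((φ.subgroupMap U).trans (MulEquiv.subgroupCongr hUφ')).trans ρ, fun N i j ↦ ?_⟩
  rw [MulEquiv.trans_apply, MulEquiv.trans_apply, hρ]
  have hval : (((MulEquiv.subgroupCongr hUφ') ((φ.subgroupMap U) N) : SpecialLinearGroup (Fin m ⊕ Fin m) ℂ) :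
      Matrix (Fin m ⊕ Fin m) (Fin m ⊕ Fin m) ℂ) =
      Q⁻¹ * ((N : SpecialLinearGroup (Fin 2 × Fin m) ℂ) : Matrix (Fin 2 × Fin m) (Fin 2 × Fin m) ℂ).submatrix
        ε.symm ε.symm * Q := hφ N
  obtain ⟨X', B', C', Y', hN⟩ : ∃ X B C Y : Matrix (Fin m) (Fin m) ℂ,
      ((N : SpecialLinearGroup (Fin 2 × Fin m) ℂ) : Matrix (Fin 2 × Fin m) (Fin 2 × Fin m) ℂ).submatrix
        ε.symm ε.symm = fromBlocks X B C Y :=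
    ⟨_, _, _, _, (fromBlocks_toBlocks _).symm⟩
  have hX' : ∀ i j, X' i j = ((N : SpecialLinearGroup (Fin 2 × Fin m) ℂ) :
      Matrix (Fin 2 × Fin m) (Fin 2 × Fin m) ℂ) (0, i) (0, j) := fun i j ↦ by
    have h := congrFun (congrFun hN (Sum.inl i)) (Sum.inl j)
    rw [Matrix.submatrix_apply, hεl, hεl, fromBlocks_apply₁₁] at h
    exact h.symm
  rw [hval, hN, hQinv, hQ, fromBlocks_multiply, fromBlocks_multiply]
  simp only [Matrix.mul_zero, Matrix.zero_mul, add_zero, Matrix.one_mul, Matrix.mul_one, toBlocks_fromBlocks₁₁]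
  exact hX' i j

end UnitaryPair

/-! ## §2 `S(X)(ℂ) ≃* ∏_w GL_{m_w}(ℂ)` from a complete family of paired matrix-unit systems -/

section Assembly

variable {ι : Type*} [Fintype ι] [DecidableEq ι] {E : Type*} [NormedAddCommGroup E] [NormedSpace ℂ E]
  (Φ : (ι → ℝ) ≃L[ℝ] E)

/-- **`S(X)(ℂ) ≃* ∏_{w} GL_{m_w}(ℂ)` WITH THE BLOCK SIZES AS RANKS: `rank (Σ_a e w s a a) = d · m_w`,
`d · Σ_w 2 m_w = #ι`**, for a complete family of paired `d × d` matrix-unit systems in `End_ℚ(X) ⊗ ℂ` whose adjoints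
swap the pairs (hypotheses of `exists_frame_lefschetzGroupC_eq_conj_diagPow_pi_of_matrixUnitPairFamily`): the
paired-frame identity `S(X)(ℂ) = P · eι(Δ_d(diag_w U_w)) · P⁻¹` composed with `U_w ≃* GL_{m_w}(ℂ)` (§1); the projector
`ε_{w,s} = Σ_a e w s a a = P (1_d ⊗ Π_{w,s}) P⁻¹` onto `V_{w,s}` («`V_σ = V₁ ⊕ V₂`», `d` copies of the standard
representation) has rank `d · m_w` (`rank_sum_eq_of_mul_eq_mul_single_kronecker_submatrix`).
[cite: Milne1999LefschetzClasses, §2 «Simple abelian variety of type IV» (p. 651) and Remark 2.2 (p. 647–648), Summary table (p. 652: «IV ∣ GL_{g/(df)}»)]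
[cite: Lange2023AbelianVarietiesComplex, Thm. 2.6.5 and §7.2.4 Exercise (4)] -/
theorem exists_rank_eq_and_mulEquiv_lefschetzGroupC_pi_generalLinearGroup_of_matrixUnitPairFamily {W : Type*}
    [Fintype W] [DecidableEq W] {d : ℕ} [NeZero d] {G : Matrix ι ι ℚ} (hGt : Gᵀ = -G) (hGu : IsUnit G.det)
    {e : W → Fin 2 → Fin d → Fin d → Matrix ι ι ℂ}
    (hmul : ∀ (w w' : W) (s s' : Fin 2) (a b c d' : Fin d),
      e w s a b * e w' s' c d' = if w = w' ∧ s = s' ∧ b = c then e w s a d' else 0)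
    (hone : ∑ w, ∑ s, ∑ a, e w s a a = 1)
    (hspan : ∀ w s a b,
      e w s a b ∈ Submodule.span ℂ ((fun A : Matrix ι ι ℚ ↦ A.map (algebraMap ℚ ℂ)) '' (endAlgRat Φ : Set (Matrix ι ι ℚ))))
    (habs : ∀ A ∈ endAlgRat Φ, A.map (algebraMap ℚ ℂ) ∈
      Submodule.span ℂ (Set.range fun p : W × Fin 2 × Fin d × Fin d ↦ e p.1 p.2.1 p.2.2.1 p.2.2.2))
    (hadj : ∀ w s a b, rosati (G.map (algebraMap ℚ ℂ)) (e w s a b) = e w s.rev b a) :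
    ∃ m : W → ℕ, d * ∑ w, 2 * m w = Fintype.card ι ∧ (∀ w s, (∑ a, e w s a a).rank = d * m w) ∧
      Nonempty (lefschetzGroupC Φ G ≃* ((w : W) → GL (Fin (m w)) ℂ)) := by
  obtain ⟨m, eι, P, hP, Hb, K, hHbt, hHbu, hside, hKmem, -, -, hframe, hS⟩ :=
    exists_frame_lefschetzGroupC_eq_conj_diagPow_pi_of_matrixUnitPairFamily Φ hGt hGu hmul hone hspan habs hadj
  have hρ : ∀ w, ∃ ρ : K w ≃* GL (Fin (m w)) ℂ, ∀ (N : K w) (i j : Fin (m w)),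
      ((ρ N : GL (Fin (m w)) ℂ) : Matrix (Fin (m w)) (Fin (m w)) ℂ) i j =
        ((N : SpecialLinearGroup (Fin 2 × Fin (m w)) ℂ) : Matrix (Fin 2 × Fin (m w)) (Fin 2 × Fin (m w)) ℂ)
          (0, i) (0, j) := fun w ↦
    exists_mulEquiv_generalLinearGroup_of_unitaryPair (hHbt w) (hHbu w) (hside w) (hKmem w)
  choose ρ _hρ using hρ
  -- `∏_w U_w ≃* S(X)(ℂ)` along the frame identity
  let K₁ : Subgroup (SpecialLinearGroup (Σ w, Fin 2 × Fin (m w)) ℂ) :=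
    (Subgroup.pi Set.univ K).map (sigmaBlockDiagSL (fun w ↦ Fin 2 × Fin (m w)) ℂ)
  let K₂ : Subgroup (SpecialLinearGroup (Fin d × Σ w, Fin 2 × Fin (m w)) ℂ) :=
    K₁.map (diagPowSLC (Σ w, Fin 2 × Fin (m w)) d)
  let K₃ : Subgroup (SpecialLinearGroup ι ℂ) := K₂.map (reindexSLC eι).toMonoidHom
  have ψ₀ : ((w : W) → K w) ≃* Subgroup.pi Set.univ K := subgroupPiMulEquiv' K
  have ψ₁ : Subgroup.pi Set.univ K ≃* K₁ :=
    (Subgroup.pi Set.univ K).equivMapOfInjective _ sigmaBlockDiagSL_injective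
  have ψ₂ : K₁ ≃* K₂ := K₁.equivMapOfInjective _ (diagPowSLC_injective d (NeZero.pos d))
  have ψ₃ : K₂ ≃* K₃ :=
    K₂.equivMapOfInjective (reindexSLC eι).toMonoidHom fun a b h ↦ (reindexSLC eι).injective h
  have ψ₄ : K₃ ≃* K₃.map (conjGLC P hP).toMonoidHom :=
    K₃.equivMapOfInjective (conjGLC P hP).toMonoidHom fun a b h ↦ (conjGLC P hP).injective h
  have ψ₅ : K₃.map (conjGLC P hP).toMonoidHom ≃* lefschetzGroupC Φ G := MulEquiv.subgroupCongr hS.symm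
  have ψ : ((w : W) → K w) ≃* lefschetzGroupC Φ G := (((ψ₀.trans ψ₁).trans ψ₂).trans ψ₃).trans (ψ₄.trans ψ₅)
  refine ⟨m, ?_, fun w s ↦ rank_sum_eq_of_mul_eq_mul_single_kronecker_submatrix eι hP w s fun a ↦ hframe w s a a,
    ⟨ψ.symm.trans (MulEquiv.piCongrRight ρ)⟩⟩
  rw [← Fintype.card_congr eι, Fintype.card_prod, Fintype.card_fin, Fintype.card_sigma]
  simp only [Fintype.card_prod, Fintype.card_fin]

/-- **«`S(A)_{/k^al} = ∏ S_σ`, `S_σ ≈ Aut_{M_d(k^al)}(V₁) ≈ GL`» AS A GROUP ISOMORPHISM `S(X)(ℂ) ≃* ∏_{w} GL_{m_w}(ℂ)`,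
`d · Σ_w 2 m_w = #ι`**, for a complete family of paired `d × d` matrix-unit systems in `End_ℚ(X) ⊗ ℂ` whose adjoints
swap the pairs (hypotheses of `isPrime_vanishingIdealC_lefschetzGroupC_of_matrixUnitPairFamily`): the paired-frame
identity `S(X)(ℂ) = P · eι(Δ_d(diag_w U_w)) · P⁻¹` composed with `U_w ≃* GL_{m_w}(ℂ)` (§1).
[cite: Milne1999LefschetzClasses, §2 «Simple abelian variety of type IV» (p. 651) and Remark 2.2 (p. 647–648), Summary table (p. 652: «IV ∣ GL_{g/(df)}»)]
[cite: Lange2023AbelianVarietiesComplex, Thm. 2.6.5 and §7.2.4 Exercise (4)] -/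
theorem exists_mulEquiv_lefschetzGroupC_pi_generalLinearGroup_of_matrixUnitPairFamily {W : Type*} [Fintype W]
    [DecidableEq W] {d : ℕ} [NeZero d] {G : Matrix ι ι ℚ} (hGt : Gᵀ = -G) (hGu : IsUnit G.det)
    {e : W → Fin 2 → Fin d → Fin d → Matrix ι ι ℂ}
    (hmul : ∀ (w w' : W) (s s' : Fin 2) (a b c d' : Fin d),
      e w s a b * e w' s' c d' = if w = w' ∧ s = s' ∧ b = c then e w s a d' else 0)
    (hone : ∑ w, ∑ s, ∑ a, e w s a a = 1)
    (hspan : ∀ w s a b,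
      e w s a b ∈ Submodule.span ℂ ((fun A : Matrix ι ι ℚ ↦ A.map (algebraMap ℚ ℂ)) '' (endAlgRat Φ : Set (Matrix ι ι ℚ))))
    (habs : ∀ A ∈ endAlgRat Φ, A.map (algebraMap ℚ ℂ) ∈
      Submodule.span ℂ (Set.range fun p : W × Fin 2 × Fin d × Fin d ↦ e p.1 p.2.1 p.2.2.1 p.2.2.2))
    (hadj : ∀ w s a b, rosati (G.map (algebraMap ℚ ℂ)) (e w s a b) = e w s.rev b a) :
    ∃ m : W → ℕ, d * ∑ w, 2 * m w = Fintype.card ι ∧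
      Nonempty (lefschetzGroupC Φ G ≃* ((w : W) → GL (Fin (m w)) ℂ)) := by
  obtain ⟨m, hm, -, hiso⟩ :=
    exists_rank_eq_and_mulEquiv_lefschetzGroupC_pi_generalLinearGroup_of_matrixUnitPairFamily Φ hGt hGu hmul hone
      hspan habs hadj
  exact ⟨m, hm, hiso⟩

/-- **«`f` COPIES OF `GL_{g/(df)}`»: THE BLOCK SIZES ARE UNIFORM.**  If, in addition, `2 · #W = [K:ℚ]` for a number
field `f : K → End_ℚ(X)` of CENTRAL endomorphisms (`ι ≠ ∅`; the CM centre, `#W = e₀` its complex places), then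
`S(X)(ℂ) ≃* GL_m(ℂ)^W` with ONE `m`, `d · m · [K:ℚ] = #ι`: by the paired centre dictionary
(`exists_equiv_embeddings_of_matrixUnitPairFamily_of_central`: `ε_{w,s} = Σ_a e w s a a` is the spectral projector of
`K` at the embedding `c (w,s)`, `(w,s) ↦ c (w,s)` a bijection `W × {0,1} ≃ Hom(K, ℂ)` — «`σ₁, σ₂` the extensions of
`σ`» — and `rank ε_{w,s} · [K:ℚ] = #ι`) all the ranks `rank ε_{w,s} = d · m_w` of
`exists_rank_eq_and_mulEquiv_lefschetzGroupC_pi_generalLinearGroup_of_matrixUnitPairFamily` coincide.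
[cite: Milne1999LefschetzClasses, §2 p. 646–647 («`V_i = e_i V` … dimension `2g/f`», Prop. 2.1), p. 651 («`S_σ ≈ GL_{g/(fd)}`») and Summary table (p. 652: «IV ∣ GL_{g/(df)}», «`f` copies of the group listed»)]
[cite: Lange2023AbelianVarietiesComplex, Thm. 2.6.5 ∕ §2.6.1 (type IV: `[K:ℚ] = 2e₀`, `e₀` factors `M_d(ℂ)`) and §7.2.4 Exercise (4)] -/
theorem exists_mulEquiv_lefschetzGroupC_fun_generalLinearGroup_of_matrixUnitPairFamily_of_central [Nonempty ι]
    {W : Type*} [Fintype W] [DecidableEq W] {d : ℕ} [NeZero d] {G : Matrix ι ι ℚ} (hGt : Gᵀ = -G)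
    (hGu : IsUnit G.det) {K : Type*} [Field K] [NumberField K] (f : K →ₐ[ℚ] Matrix ι ι ℚ)
    (hfE : ∀ k, f k ∈ endAlgRat Φ) (hfc : ∀ k, ∀ A ∈ endAlgRat Φ, f k * A = A * f k)
    (hW : 2 * Fintype.card W = finrank ℚ K) {e : W → Fin 2 → Fin d → Fin d → Matrix ι ι ℂ}
    (hmul : ∀ (w w' : W) (s s' : Fin 2) (a b c d' : Fin d),
      e w s a b * e w' s' c d' = if w = w' ∧ s = s' ∧ b = c then e w s a d' else 0)
    (hone : ∑ w, ∑ s, ∑ a, e w s a a = 1)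
    (hspan : ∀ w s a b,
      e w s a b ∈ Submodule.span ℂ ((fun A : Matrix ι ι ℚ ↦ A.map (algebraMap ℚ ℂ)) '' (endAlgRat Φ : Set (Matrix ι ι ℚ))))
    (habs : ∀ A ∈ endAlgRat Φ, A.map (algebraMap ℚ ℂ) ∈
      Submodule.span ℂ (Set.range fun p : W × Fin 2 × Fin d × Fin d ↦ e p.1 p.2.1 p.2.2.1 p.2.2.2))
    (hadj : ∀ w s a b, rosati (G.map (algebraMap ℚ ℂ)) (e w s a b) = e w s.rev b a) :
    ∃ m : ℕ, d * m * finrank ℚ K = Fintype.card ι ∧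
      Nonempty (lefschetzGroupC Φ G ≃* (W → GL (Fin m) ℂ)) := by
  obtain ⟨m, -, hrank, ⟨ψ⟩⟩ :=
    exists_rank_eq_and_mulEquiv_lefschetzGroupC_pi_generalLinearGroup_of_matrixUnitPairFamily Φ hGt hGu hmul hone
      hspan habs hadj
  obtain ⟨-, -, -, hunif, -⟩ :=
    exists_equiv_embeddings_of_matrixUnitPairFamily_of_central Φ f hfE hfc hW hmul hone hspan habs
  have hf : 0 < finrank ℚ K := finrank_pos
  have hWne : Nonempty W := by
    rw [← Fintype.card_pos_iff]
    omega
  obtain ⟨w₀⟩ := hWne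
  have hdm : ∀ w, d * m w * finrank ℚ K = Fintype.card ι := fun w ↦ by rw [← hrank w 0]; exact hunif w 0
  have hmm : ∀ w, m w = m w₀ := fun w ↦ by
    have h1 : d * m w = d * m w₀ := Nat.eq_of_mul_eq_mul_right hf ((hdm w).trans (hdm w₀).symm)
    exact Nat.eq_of_mul_eq_mul_left (NeZero.pos d) h1
  obtain ⟨m₀, hm₀⟩ : ∃ m₀, ∀ w, m w = m₀ := ⟨m w₀, hmm⟩
  have hm₂ := hdm w₀
  rw [hm₀ w₀] at hm₂
  obtain rfl : m = fun _ ↦ m₀ := funext hm₀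
  exact ⟨m₀, hm₂, ⟨ψ⟩⟩

end Assembly

/-! ## §3 Simple abelian varieties of Albert type IV, every degree `d` -/

section TypeFour

variable {κ : Type} [Fintype κ] [DecidableEq κ] [Nonempty κ] {E : Type} [NormedAddCommGroup E] [NormedSpace ℂ E]
  {Ψ : (κ → ℝ) ≃L[ℝ] E} {η : E [⋀^Fin 2]→L[ℝ] ℝ} {G : Matrix κ κ ℚ}

/-- **MILNE'S «GROUP» COLUMN, TYPE IV, EVERY DEGREE `d`: `S(X)(ℂ) ≃* ∏_{w : InfinitePlace K} GL_{m_w}(ℂ)` with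
`d · Σ_w 2 m_w = 2g`, `d = √[End⁰(X) : K]`**, for a SIMPLE polarised complex torus whose Rosati pair `(End⁰(X), ′)` is of
Albert type IV over its CM centre `K` («`S(A)_{/k^al} = ∏ S_σ`, `S_σ ≈ Aut_{M_d}(V₁) ≈ GL_{g/(fd)}`»; the pair family is
FILE 2's `IsSimple.exists_matrixUnitPairFamily_of_isAlbertTypeIV`).
(The block sizes are in fact uniform, `m_w = g/(d e₀)`:
`IsSimple.nonempty_lefschetzGroupC_mulEquiv_fun_generalLinearGroup_of_isAlbertTypeIV` below.)
[cite: Milne1999LefschetzClasses, §2 «Simple abelian variety of type IV» (p. 651), Remark 2.2 and Summary table (p. 652)]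
[cite: Lange2023AbelianVarietiesComplex, Thm. 2.6.5 ∕ §2.6.1 (type IV) and §7.2.4 Exercise (4)] -/
theorem IsSimple.nonempty_lefschetzGroupC_mulEquiv_pi_generalLinearGroup_of_isAlbertTypeIV (hX : IsSimple Ψ)
    (hη : IsRiemannForm Ψ η) (hG : G.map (Rat.cast : ℚ → ℝ) = latticeGram Ψ η)
    (h : IsAlbertTypeIV (centerField Ψ hX) (endAlgRat Ψ) (rosatiEnd Ψ hη.1 hη.2.2 hG)) :
    ∃ m : InfinitePlace (centerField Ψ hX) → ℕ,
      Nat.sqrt (finrank (centerField Ψ hX) (endAlgRat Ψ)) * ∑ w, 2 * m w = Fintype.card κ ∧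
      Nonempty (lefschetzGroupC Ψ G ≃* ((w : InfinitePlace (centerField Ψ hX)) → GL (Fin (m w)) ℂ)) := by
  classical
  obtain ⟨e, hdiag, hoff, hone, hspan, habs, hadj⟩ := hX.exists_matrixUnitPairFamily_of_isAlbertTypeIV hη hG h
  -- `d ≥ 1`: otherwise the completeness relation reads `0 = 1`
  haveI : NeZero (Nat.sqrt (finrank (centerField Ψ hX) (endAlgRat Ψ))) := by
    refine ⟨fun h0 ↦ ?_⟩
    haveI : IsEmpty (Fin (Nat.sqrt (finrank (centerField Ψ hX) (endAlgRat Ψ)))) := ⟨fun x ↦ (Fin.cast h0 x).elim0⟩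
    have h1 := hone
    simp only [Finset.univ_eq_empty, Finset.sum_empty, Finset.sum_const_zero] at h1
    exact zero_ne_one h1
  have hmul : ∀ (w w' : InfinitePlace (centerField Ψ hX)) (s s' : Fin 2) (a b c d' : Fin _),
      e w s a b * e w' s' c d' = if w = w' ∧ s = s' ∧ b = c then e w s a d' else 0 := by
    intro w w' s s' a b c d'
    by_cases hw : w = w'
    · subst hw
      rw [hdiag]
      by_cases hsc : s = s' ∧ b = c
      · rw [if_pos hsc, if_pos ⟨rfl, hsc⟩]
      · rw [if_neg hsc, if_neg fun H ↦ hsc H.2]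
    · rw [hoff w w' hw, if_neg fun H ↦ hw H.1]
  exact exists_mulEquiv_lefschetzGroupC_pi_generalLinearGroup_of_matrixUnitPairFamily Ψ
    (transpose_eq_neg_of_map_ratCast Ψ hG) (isUnit_det_of_map_ratCast hG (isUnit_det_latticeGram Ψ hη.1 hη.2.2))
    hmul hone hspan habs hadj

/-- **TYPE IV, EVERY DEGREE, LANGE'S `Lf(X)`: `Lf(X)(ℂ) ≃* ∏_{w : InfinitePlace K} GL_{m_w}(ℂ)`** («Connected: Yes»:
`Lf = S` by FILE 2's `IsSimple.lefschetzIdentityC_eq_lefschetzGroupC_of_isAlbertTypeIV`). [cite: Milne1999LefschetzClasses, §2 Summary table (p. 652: «IV ∣ GL_{g/(df)} ∣ No ∣ Yes»)]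
[cite: Lange2023AbelianVarietiesComplex, §7.2.4 Exercise (4)] -/
theorem IsSimple.nonempty_lefschetzIdentityC_mulEquiv_pi_generalLinearGroup_of_isAlbertTypeIV (hX : IsSimple Ψ)
    (hη : IsRiemannForm Ψ η) (hG : G.map (Rat.cast : ℚ → ℝ) = latticeGram Ψ η)
    (h : IsAlbertTypeIV (centerField Ψ hX) (endAlgRat Ψ) (rosatiEnd Ψ hη.1 hη.2.2 hG)) :
    ∃ m : InfinitePlace (centerField Ψ hX) → ℕ,
      Nat.sqrt (finrank (centerField Ψ hX) (endAlgRat Ψ)) * ∑ w, 2 * m w = Fintype.card κ ∧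
      Nonempty (lefschetzIdentityC Ψ G ≃* ((w : InfinitePlace (centerField Ψ hX)) → GL (Fin (m w)) ℂ)) := by
  obtain ⟨m, hm, ⟨ψ⟩⟩ := hX.nonempty_lefschetzGroupC_mulEquiv_pi_generalLinearGroup_of_isAlbertTypeIV hη hG h
  exact ⟨m, hm, ⟨(MulEquiv.subgroupCongr (hX.lefschetzIdentityC_eq_lefschetzGroupC_of_isAlbertTypeIV hη hG h)).trans ψ⟩⟩

/-- **MILNE'S TABLE ENTRY WITH ITS MULTIPLICITY, TYPE IV (EVERY DEGREE `d`):
`S(X)(ℂ) ≃* GL_m(ℂ)^{InfinitePlace K}`, `d · m · [K:ℚ] = 2g` — EXACTLY «`f` COPIES OF `GL_{g/(df)}`»** (`f = e₀ =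
#InfinitePlace K`, `[K:ℚ] = 2e₀` for the CM centre `K` of `End⁰(X)`, `d = √[End⁰(X):K]`), for a SIMPLE polarised
complex torus of Albert type IV: FILE 2's `InfinitePlace K`-indexed pair family is complete, the centre `K` acts on it
centrally, and `2 · #InfinitePlace K = [K:ℚ]` (`K` totally complex); so the paired centre dictionary makes all block
sizes equal (`exists_mulEquiv_lefschetzGroupC_fun_generalLinearGroup_of_matrixUnitPairFamily_of_central`).
[cite: Milne1999LefschetzClasses, §2 «Simple abelian variety of type IV» (p. 651: «`S_σ ≈ Aut_{M_d(k^al)}(V₁) ≈ GL_{g/(fd)}(k^al)`»), p. 646–647 and Summary table (p. 652: «IV ∣ GL_{g/(df)} ∣ No ∣ Yes», «`f` copies»)]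
[cite: Lange2023AbelianVarietiesComplex, Thm. 2.6.5 ∕ §2.6.1 (type IV: «`End_ℚ(X) ⊗ ℝ ≃ ∏_{e₀} M_d(ℂ)`», `[K:ℚ] = 2e₀`) and §7.2.4 Exercise (4)] -/
theorem IsSimple.nonempty_lefschetzGroupC_mulEquiv_fun_generalLinearGroup_of_isAlbertTypeIV (hX : IsSimple Ψ)
    (hη : IsRiemannForm Ψ η) (hG : G.map (Rat.cast : ℚ → ℝ) = latticeGram Ψ η)
    (h : IsAlbertTypeIV (centerField Ψ hX) (endAlgRat Ψ) (rosatiEnd Ψ hη.1 hη.2.2 hG)) :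
    ∃ m : ℕ, Nat.sqrt (finrank (centerField Ψ hX) (endAlgRat Ψ)) * m * finrank ℚ (centerField Ψ hX) =
        Fintype.card κ ∧
      Nonempty (lefschetzGroupC Ψ G ≃* (InfinitePlace (centerField Ψ hX) → GL (Fin m) ℂ)) := by
  classical
  obtain ⟨e, hdiag, hoff, hone, hspan, habs, hadj⟩ := hX.exists_matrixUnitPairFamily_of_isAlbertTypeIV hη hG h
  -- `d ≥ 1`: otherwise the completeness relation reads `0 = 1`
  haveI : NeZero (Nat.sqrt (finrank (centerField Ψ hX) (endAlgRat Ψ))) := by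
    refine ⟨fun h0 ↦ ?_⟩
    haveI : IsEmpty (Fin (Nat.sqrt (finrank (centerField Ψ hX) (endAlgRat Ψ)))) := ⟨fun x ↦ (Fin.cast h0 x).elim0⟩
    have h1 := hone
    simp only [Finset.univ_eq_empty, Finset.sum_empty, Finset.sum_const_zero] at h1
    exact zero_ne_one h1
  have hmul : ∀ (w w' : InfinitePlace (centerField Ψ hX)) (s s' : Fin 2) (a b c d' : Fin _),
      e w s a b * e w' s' c d' = if w = w' ∧ s = s' ∧ b = c then e w s a d' else 0 := by
    intro w w' s s' a b c d'
    by_cases hw : w = w'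
    · subst hw
      rw [hdiag]
      by_cases hsc : s = s' ∧ b = c
      · rw [if_pos hsc, if_pos ⟨rfl, hsc⟩]
      · rw [if_neg hsc, if_neg fun H ↦ hsc H.2]
    · rw [hoff w w' hw, if_neg fun H ↦ hw H.1]
  -- the CM centre is totally complex: `2 · #InfinitePlace K = [K:ℚ]`
  haveI := h.isCMField
  have hW : 2 * Fintype.card (InfinitePlace (centerField Ψ hX)) = finrank ℚ (centerField Ψ hX) := by
    rw [InfinitePlace.card_eq_nrRealPlaces_add_nrComplexPlaces, IsTotallyComplex.nrRealPlaces_eq_zero, zero_add,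
      ← IsTotallyComplex.finrank]
  exact exists_mulEquiv_lefschetzGroupC_fun_generalLinearGroup_of_matrixUnitPairFamily_of_central Ψ
    (transpose_eq_neg_of_map_ratCast Ψ hG) (isUnit_det_of_map_ratCast hG (isUnit_det_latticeGram Ψ hη.1 hη.2.2))
    (centerField.valAlgHom Ψ hX) (fun k ↦ centerField.val_mem Ψ hX k)
    (fun k A hA ↦ centerField.val_comm Ψ hX k hA) hW hmul hone hspan habs hadj

/-- **TYPE IV WITH ITS MULTIPLICITY, LANGE'S `Lf(X)`: `Lf(X)(ℂ) ≃* GL_m(ℂ)^{InfinitePlace K}`, `d · m · [K:ℚ] = 2g`**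
(«IV ∣ GL_{g/(df)} ∣ No ∣ Yes», «`f` copies»; `Lf = S` by FILE 2's
`IsSimple.lefschetzIdentityC_eq_lefschetzGroupC_of_isAlbertTypeIV`).
[cite: Milne1999LefschetzClasses, §2 Summary table (p. 652: «IV ∣ GL_{g/(df)} ∣ No ∣ Yes», «`f` copies»)]
[cite: Lange2023AbelianVarietiesComplex, §7.2.4 Exercise (4)] -/
theorem IsSimple.nonempty_lefschetzIdentityC_mulEquiv_fun_generalLinearGroup_of_isAlbertTypeIV (hX : IsSimple Ψ)
    (hη : IsRiemannForm Ψ η) (hG : G.map (Rat.cast : ℚ → ℝ) = latticeGram Ψ η)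
    (h : IsAlbertTypeIV (centerField Ψ hX) (endAlgRat Ψ) (rosatiEnd Ψ hη.1 hη.2.2 hG)) :
    ∃ m : ℕ, Nat.sqrt (finrank (centerField Ψ hX) (endAlgRat Ψ)) * m * finrank ℚ (centerField Ψ hX) =
        Fintype.card κ ∧
      Nonempty (lefschetzIdentityC Ψ G ≃* (InfinitePlace (centerField Ψ hX) → GL (Fin m) ℂ)) := by
  obtain ⟨m, hm, ⟨ψ⟩⟩ := hX.nonempty_lefschetzGroupC_mulEquiv_fun_generalLinearGroup_of_isAlbertTypeIV hη hG h
  exact ⟨m, hm, ⟨(MulEquiv.subgroupCongr (hX.lefschetzIdentityC_eq_lefschetzGroupC_of_isAlbertTypeIV hη hG h)).trans ψ⟩⟩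

end TypeFour

end ComplexTorus

end Literature.Geometry.Kaehler
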